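import Summits.QuantumFields.BalabanUV.T4Continuum.Support.NE3DecomposedRepOfShapes
import Summits.QuantumFields.BalabanUV.T4Continuum.Support.NE3QuadRemainderLocalBox
import HarnessLib

/-!
# T⁴ programme, node NE3 — route Π, THE JUNCTION IN THE BOX CURRENCY: `DecomposedRep` from the R-adapted residual slice representative and
# the SHARPER (Π-REG) leaf `NE3LinearNormalPartPreSizes.LocalSupMajorant` (majorant on the PRINTED dependency box `B^k(c₋) ∪ B^k(c₊)`),
# plus «the box of record lies in the dependency ball» so that the ball-form junction (owner's file 4) is a corollary

NE3 (node U1b) formalisation swarm `b2b-balaban-t4-ne3-formalise-*`, LEAF PROVER 02 (gen 8).  Inputs BY NAME: the owner's file 4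
`NE3DecomposedRepOfShapes` (shape `LocalSupMajorantBall`, proof pattern of `decomposedRep_of_shapes`), file 2
`NE3DecomposedRepOfLinearNormalPart.decomposedRep_of_linearNormalPart` (+ shape `ResidualSliceRepT`), file 3a
`NE3LinearNormalPartPreSizes.{LocalSupMajorant, preSizes_of_letters}`, this lineage's Π-C-3e `NE3QuadRemainderLocalBox.norm_dirIter_le_of_fibre_box`
(the linearised average of the relative field of a fibre point is locally quadratically small ON THE BOX OF RECORD `[loK L k z, bondHiK L k z κ]`),
leaf-04-g7's 3b `NE3ProductPathPlaquettes.small_of_residual_data_poly`, file 1's `NE3ResidualSliceRep.{normalPart, norm_normalPart_sub_le, normalPart_skew}`.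

WHAT.  §1 `l1_le_depRad_of_inBox`: a bond with both endpoints in the box of record `[L^k•z, L^k•z + (L^k − 1)𝟙 + L^k e_κ]` starts within
ℓ¹-distance `depRad d L k` of the corner `L^k•z` (coordinatewise count `(d+1)(L^k − 1) ≤ depRad d L k`), hence **`localSupMajorant_of_ball`**: a
ball majorant is a box majorant with the same `m`, `C` — the box leaf is the WEAKER hypothesis.  §2 **`decomposedRep_of_shapes_box`**: the owner's
junction `NE3DecomposedRepOfShapes.decomposedRep_of_shapes` VERBATIM in hypotheses and conclusion except that the majorant leaf is the BOX form
`LocalSupMajorant L N (j+1) X₀ m C` (the owner's own «sharper target», file 4 docstring; `(dL)^d` times fewer bonds per coarse bond than the ball,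
which is what the constant `C` of `sq` pays for); step (1) of the proof reads the local quadratic letter from `norm_dirIter_le_of_fibre_box` instead of
`norm_dirIter_le_of_fibre_local`, steps (2)–(4) are the owner's.  By §1 the ball-form junction is `decomposedRep_of_shapes_box ∘ localSupMajorant_of_ball`
(not restated).

HONEST FRAMING.  Bookkeeping over landed kernel theorems + one lattice-geometry count; the two shapes (`ResidualSliceRepT`, `LocalSupMajorant`), the
fibre equation, the letters of `Nn`, the window radii and the numeric lines are HYPOTHESES (suppliers: file 1 on `sfClass`; Π-R-W for the curved right
inverse; the class; the K-road); (P♮)_W's numeric lines, (H∃), T-E_w♯ and NE3 are NOT proved; spine PROVED 0∕9; finite T⁴ rung (B)+1 — NOT infinite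
volume, NOT mass gap, NOT `BetaPertH`, NOT Clay.  ABSOLUTE RULE kept (context only: [Balaban1985Averaging] p. 24 «depends only on the bond variables
`U_b` for `b ⊂ B^k(c₋) ∪ B^k(c₊)`»).  PLACEMENT: `Summits/QuantumFields/BalabanUV/`.  HONEST DEPENDENCY: continuum YM on T⁴ ⇐ BetaPertH ∧ nine spine
estimates (0/9 proved); BetaPertH ⇐ (D1) ∧ (D4) ∧ CAP+tail; G-an2-4 gates asym, D1 and NE2/3/4.
-/

set_option autoImplicit false

open scoped BigOperators Matrix.Norms.L2Operator
open NormedSpace Finset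

namespace Summit.QuantumFields.BalabanUV.T4Continuum.NE3DecomposedRepOfShapesBox

open Set
open Literature.MathematicalPhysics.QuantumFieldTheory.Balaban1983to89
open B7Prop1Explicit B7Prop2Explicit MatrixLog
open B7Prop1Local (InBox loK bondHiK add_e_apply)
open T4AveragingDeficitWall (IsSkewDir IsUnitaryCfg SmallField vary curl curlSq dirSq dirL1 fhol)
open T4AveragingDeficitWallBoundary (IsPeriodicCfg periodBox)
open AveragingDeficitPeriodicCounting (IsPeriodicDir)
open AveragingDeficitChartCalculus (cavg)
open AveragingDeficitMultiLevelPrep (cavgIter LevelSmall)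
open BlockAverageVaryDisc (rho0 rho0_pos)
open BlockAverageVaryHolo (nbRad)
open MinimalActionLevels (perWin)
open MinimalActionSandwich (admissible)
open NE3TangentCovariantTower (dirIter)
open NE3LinearisedAverageSup (curvSum)
open NE3QuadRemainderLocality (depRad)
open NE3QuadRemainderLocalBox (norm_dirIter_le_of_fibre_box)
open NE3EnergyRateWSupOfSlicePoincare (mem_frameFreeBlockLandauW_struct)
open NE3ProductPath (pathΓ)
open NE3ProductPathChart (DecomposedRep)
open NE3ProductPathPlaquettes (small_of_residual_data_poly)
open NE3ResidualSliceRep (normalPart norm_normalPart_sub_le normalPart_skew)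
open NE3DecomposedRepOfLinearNormalPart (ResidualSliceRepT decomposedRep_of_linearNormalPart)
open NE3LinearNormalPartPreSizes (LocalSupMajorant preSizes_of_letters)
open NE3DecomposedRepOfShapes (LocalSupMajorantBall)

noncomputable section

variable {d : ℕ} {n : Type*} [Fintype n] [DecidableEq n]

/-! ## §1 The box of record lies in the dependency ball -/

omit [Fintype n] [DecidableEq n] in
/-- `(d+1)·L^k ≤ depRad d L k + (d+1)`: the dependency radius `depRad d L k = nbRad·(1 + L + ⋯ + L^{k−1})`, `nbRad = 2L(d+1)`, dominates the
ℓ¹-diameter `(d+1)(L^k − 1)` of the box of record seen from its lower corner. [folklore] -/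
theorem succ_mul_pow_le_depRad (L : ℕ) : ∀ k : ℕ, (d + 1) * L ^ k ≤ depRad d L k + (d + 1)
  | 0 => by simp [depRad]
  | k + 1 => by
      have ih := succ_mul_pow_le_depRad L k
      show (d + 1) * L ^ (k + 1) ≤ L * depRad d L k + nbRad d L + (d + 1)
      have h1 : (d + 1) * L ^ (k + 1) = L * ((d + 1) * L ^ k) := by ring
      have h2 : L * ((d + 1) * L ^ k) ≤ L * (depRad d L k + (d + 1)) := Nat.mul_le_mul_left L ih
      have h3 : nbRad d L = 2 * (d * L) + 2 * L := rfl
      have h4 : L * (depRad d L k + (d + 1)) = L * depRad d L k + (d * L + L) := by ring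
      have h5 : d * L + L ≤ nbRad d L + (d + 1) := by rw [h3]; omega
      calc (d + 1) * L ^ (k + 1) = L * ((d + 1) * L ^ k) := h1
        _ ≤ L * (depRad d L k + (d + 1)) := h2
        _ = L * depRad d L k + (d * L + L) := h4
        _ ≤ L * depRad d L k + (nbRad d L + (d + 1)) := Nat.add_le_add_left h5 _
        _ = L * depRad d L k + nbRad d L + (d + 1) := (Nat.add_assoc _ _ _).symm

omit [Fintype n] [DecidableEq n] in
/-- **THE BOX OF RECORD LIES IN THE DEPENDENCY BALL**: if both endpoints of the bond `(y, μ)` lie in the box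
`[loK L k z, bondHiK L k z κ] = B^k(c₋) ∪ B^k(c₊)` of the coarse bond `c = (z, κ)`, then `l1 (y − L^k•z) ≤ depRad d L k` — so every hypothesis
«on the dependency ball of radius `depRad d L k` about `L^k•z`» (Π-C-3♭∕3c∕3d, `LocalSupMajorantBall`) is implied by the same hypothesis on the box.
[cite: Balaban1985Averaging, p.24 (sentence after (43))] -/
theorem l1_le_depRad_of_inBox (L k : ℕ) (z : Site d) (κ : Fin d) {y : Site d} {μ : Fin d}
    (hy : InBox (loK L k z) (bondHiK L k z κ) y) (hyμ : InBox (loK L k z) (bondHiK L k z κ) (y + e μ)) :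
    l1 (y - ((L : ℤ) ^ k) • z) ≤ depRad d L k := by
  -- the coordinates of `v := y − L^k•z` are non-negative …
  have hlo : ∀ i, 0 ≤ (y - ((L : ℤ) ^ k) • z) i := fun i => by
    have h := (hy i).1
    simp only [loK] at h
    simp only [Pi.sub_apply, Pi.smul_apply, smul_eq_mul]
    linarith
  -- … and, the far endpoint `y + e μ` being in the box, bounded above with one unit to spare in direction `μ`
  have hhi : ∀ i, (y - ((L : ℤ) ^ k) • z) i + (if i = μ then (1 : ℤ) else 0)
      ≤ ((L : ℤ) ^ k - 1) + (if i = κ then (L : ℤ) ^ k else 0) := fun i => by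
    have h := (hyμ i).2
    rw [add_e_apply] at h
    simp only [bondHiK] at h
    simp only [Pi.sub_apply, Pi.smul_apply, smul_eq_mul]
    linarith
  -- sum over the coordinates
  have hcast : ((l1 (y - ((L : ℤ) ^ k) • z) : ℕ) : ℤ) = ∑ i, (y - ((L : ℤ) ^ k) • z) i := by
    unfold l1
    push_cast
    exact Finset.sum_congr rfl fun i _ => abs_of_nonneg (hlo i)
  have hsum : ((l1 (y - ((L : ℤ) ^ k) • z) : ℕ) : ℤ) + 1 ≤ (d : ℤ) * ((L : ℤ) ^ k - 1) + (L : ℤ) ^ k := by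
    have h1 : ∑ i : Fin d, ((y - ((L : ℤ) ^ k) • z) i + (if i = μ then (1 : ℤ) else 0))
        ≤ ∑ i : Fin d, (((L : ℤ) ^ k - 1) + (if i = κ then (L : ℤ) ^ k else 0)) := Finset.sum_le_sum fun i _ => hhi i
    simp only [Finset.sum_add_distrib, Finset.sum_ite_eq', Finset.mem_univ, if_true, Finset.sum_const, Finset.card_univ,
      Fintype.card_fin, nsmul_eq_mul] at h1
    rw [hcast]
    linarith
  have hdep : (((d + 1) * L ^ k : ℕ) : ℤ) ≤ ((depRad d L k + (d + 1) : ℕ) : ℤ) := by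
    exact_mod_cast succ_mul_pow_le_depRad (d := d) L k
  push_cast at hdep
  have hfin : ((l1 (y - ((L : ℤ) ^ k) • z) : ℕ) : ℤ) ≤ (depRad d L k : ℤ) := by nlinarith
  exact_mod_cast hfin

/-- **A BALL MAJORANT IS A BOX MAJORANT** (same `m`, same `C`): the owner's ball-form leaf `LocalSupMajorantBall L N k X₀ m C` implies the box-form
leaf `LocalSupMajorant L N k X₀ m C` of `NE3LinearNormalPartPreSizes` — the box leaf is the weaker hypothesis, so the box-form junction §2 contains the
ball-form junction `NE3DecomposedRepOfShapes.decomposedRep_of_shapes`. [folklore] -/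
theorem localSupMajorant_of_ball {L N k : ℕ} {X₀ : Site d → Fin d → Matrix n n ℂ} {m : Site d → Fin d → ℝ} {C : ℝ}
    (h : LocalSupMajorantBall L N k X₀ m C) : LocalSupMajorant L N k X₀ m C where
  nonneg := h.nonneg
  dom z κ y μ hy hyμ := h.dom z κ y μ (l1_le_depRad_of_inBox L k z κ hy hyμ)
  hC := h.hC
  sq := h.sq

/-! ## §2 The junction in the box currency -/

/-- **`DecomposedRep` FROM THE R-ADAPTED RESIDUAL SLICE REPRESENTATIVE, THE BOX-FORM MAJORANT AND KERNEL LETTERS.**  Hypotheses and conclusion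
of `NE3DecomposedRepOfShapes.decomposedRep_of_shapes` token for token, except `hm : LocalSupMajorant L N (j+1) X₀ m C` (majorant on the box of
record `[loK L (j+1) z, bondHiK L (j+1) z κ]` only).  All letters displayed, k-free in the currencies `α₀M`, `aM²`:
`ν = (1+2048√(16d+1))·2√(c₁+c₂)·C₂·C·(α₀M)`, `C₂ = 4(3+12d)³∕rho0²`. [folklore] -/
theorem decomposedRep_of_shapes_box [Nonempty n] {𝒞 : ℕ → _root_.Set (Site d → Fin d → (Matrix n n ℂ)ˣ)} {L N : ℕ} [NeZero N]
    (hL : 2 ≤ L) (hN : 1 ≤ N) (j : ℕ) {V UA UB : Site d → Fin d → (Matrix n n ℂ)ˣ} {x : ℝ}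
    -- the tower class at the background
    (hWu : IsUnitaryCfg (cavg L UB)) (hWP : IsPeriodicCfg (cavg L UB) ((L ^ (j + 1) * N : ℕ) : ℤ)) (hx : 0 ≤ x)
    (hsm : LevelSmall d L (j + 1) x) (hWx : SmallField (cavg L UB) x) (hA : curvSum d L (j + 1) x ≤ 2 / 3 * L)
    (admW : cavg L UB ∈ admissible 𝒞 L (j + 1) V)
    -- the R-adapted residual slice representative [leaf] and the fibre equation
    {u : Site d → (Matrix n n ℂ)ˣ} {X₀ Nn : Site d → Fin d → Matrix n n ℂ} {α₀ : ℝ}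
    (h : ResidualSliceRepT L N (j + 1) (cavg L UB) UA u X₀ Nn α₀) (hα₀ : α₀ ≤ 1 / 100)
    (hσ : 4 * (3 + 12 * (d : ℝ)) ^ 2 * (L : ℝ) ^ (j + 1) * α₀ ≤ rho0 d L ^ 2)
    (hfib : cavgIter L (j + 1) (vary (cavg L UB) X₀ 1) = cavgIter L (j + 1) (cavg L UB))
    -- the majorant, BOX FORM [leaf]
    {m : Site d → Fin d → ℝ} {C : ℝ} (hm : LocalSupMajorant L N (j + 1) X₀ m C) (hmα : ∀ z κ, m z κ ≤ α₀)
    -- the linear normal part and its letters against `φ := dirIter L (j+1) W X₀`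
    {αN aN c₁ c₂ c₃ c₄ : ℝ} (hNP : IsPeriodicDir Nn ((N * L ^ (j + 1) : ℕ) : ℤ)) (hαN0 : 0 ≤ αN) (hNsup : ∀ y μ, ‖Nn y μ‖ ≤ αN)
    (hαN : αN ≤ 1 / 2700) (hJ1 : (α₀ + 43 * αN) * (L : ℝ) ^ (j + 1) ≤ 1)
    (haN : ∀ p ∈ perWin d (N * L ^ (j + 1)), ‖curl (cavg L UB) Nn p‖ ≤ aN) (haN0 : 0 ≤ aN)
    (hc₁ : 0 ≤ c₁) (hc₂ : 0 ≤ c₂) (hc₃ : 0 ≤ c₃) (hc₄ : 0 ≤ c₄)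
    (hR1 : dirSq Nn (periodBox (d := d) (N * L ^ (j + 1)))
      ≤ c₁ * (((L : ℝ) ^ (j + 1)) ^ d / ((L : ℝ) ^ (j + 1)) ^ 2) * dirSq (dirIter L (j + 1) (cavg L UB) X₀) (periodBox (d := d) N))
    (hR2 : curlSq (cavg L UB) Nn (periodBox (d := d) (N * L ^ (j + 1)))
      ≤ c₂ * (((L : ℝ) ^ (j + 1)) ^ d / ((L : ℝ) ^ (j + 1)) ^ 4) * dirSq (dirIter L (j + 1) (cavg L UB) X₀) (periodBox (d := d) N))
    (hR3 : ∑ p ∈ perWin d (N * L ^ (j + 1)), ‖curl (cavg L UB) Nn p‖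
      ≤ c₃ * (((L : ℝ) ^ (j + 1)) ^ d / ((L : ℝ) ^ (j + 1)) ^ 2) * dirL1 (dirIter L (j + 1) (cavg L UB) X₀) (periodBox (d := d) N))
    (hR4 : dirL1 Nn (periodBox (d := d) (N * L ^ (j + 1)))
      ≤ c₄ * (((L : ℝ) ^ (j + 1)) ^ d / (L : ℝ) ^ (j + 1)) * dirL1 (dirIter L (j + 1) (cavg L UB) X₀) (periodBox (d := d) N))
    -- the smallness of the ν-letter
    (hρ : 2 * (c₁ + c₂) * (4 * (3 + 12 * (d : ℝ)) ^ 3 / rho0 d L ^ 2) ^ 2 * C ^ 2 * (α₀ * (L : ℝ) ^ (j + 1)) ^ 2 ≤ 1 / 2)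
    -- window radii of `W` and of `U_A^u = W·e^{X₀}`
    {xW xA : ℝ} (hxW0 : 0 ≤ xW) (hxA0 : 0 ≤ xA)
    (hxW : ∀ p ∈ perWin d (N * L ^ (j + 1)), ‖((fhol (cavg L UB) p : (Matrix n n ℂ)ˣ) : Matrix n n ℂ) - 1‖ ≤ xW)
    (hxA : ∀ p ∈ perWin d (N * L ^ (j + 1)), ‖((fhol (vary (cavg L UB) X₀ 1) p : (Matrix n n ℂ)ˣ) : Matrix n n ℂ) - 1‖ ≤ xA) :
    DecomposedRep 𝒞 L N (j + 1) V UA UB u (fun y μ => Nn y μ - X₀ y μ) (normalPart X₀ fun y μ => Nn y μ - X₀ y μ)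
      (α₀ + αN) ((1 + 2048 * (α₀ + αN)) * αN)
      ((1 + 2048 * Real.sqrt (16 * d + 1)) * (2 * Real.sqrt (c₁ + c₂) * (4 * (3 + 12 * (d : ℝ)) ^ 3 / rho0 d L ^ 2) * C * (α₀ * (L : ℝ) ^ (j + 1))))
      (4 * c₃ * (4 * (3 + 12 * (d : ℝ)) ^ 3 / rho0 d L ^ 2) * C ^ 2
          * ((2 * xW + xA + 2 * aN + 4 * (2048 * (α₀ + αN) * αN) + 48 * α₀ ^ 2 + 1300 * ((α₀ + αN) + (1 + 2048 * (α₀ + αN)) * αN) ^ 2)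
            * ((L : ℝ) ^ (j + 1)) ^ 2)
        + 8192 * d * (4 * c₄ * (4 * (3 + 12 * (d : ℝ)) ^ 3 / rho0 d L ^ 2) * C ^ 2
          * ((2 * xW + xA + 2 * aN + 4 * (2048 * (α₀ + αN) * αN) + 48 * α₀ ^ 2 + 1300 * ((α₀ + αN) + (1 + 2048 * (α₀ + αN)) * αN) ^ 2)
            * ((L : ℝ) ^ (j + 1)) ^ 2)))
      (1806 * (4 * c₄ * (4 * (3 + 12 * (d : ℝ)) ^ 3 / rho0 d L ^ 2) * C ^ 2
          * ((2 * xW + xA + 2 * aN + 4 * (2048 * (α₀ + αN) * αN) + 48 * α₀ ^ 2 + 1300 * ((α₀ + αN) + (1 + 2048 * (α₀ + αN)) * αN) ^ 2)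
            * ((L : ℝ) ^ (j + 1)) ^ 2)))
      (2 * xW + xA + 2 * aN + 4 * (2048 * (α₀ + αN) * αN) + 48 * α₀ ^ 2 + 1300 * ((α₀ + αN) + (1 + 2048 * (α₀ + αN)) * αN) ^ 2) := by
  have hL1 : 1 ≤ L := by omega
  -- the constant of Π-C and the plaquette radius, as reals
  set C₂ : ℝ := 4 * (3 + 12 * (d : ℝ)) ^ 3 / rho0 d L ^ 2 with hC₂def
  set a : ℝ := 2 * xW + xA + 2 * aN + 4 * (2048 * (α₀ + αN) * αN) + 48 * α₀ ^ 2
    + 1300 * ((α₀ + αN) + (1 + 2048 * (α₀ + αN)) * αN) ^ 2 with hadef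
  have hρ0 : 0 < rho0 d L := rho0_pos (d := d) hL1
  have hC₂0 : 0 ≤ C₂ := by rw [hC₂def]; positivity
  have hα₀0 : 0 ≤ α₀ := h.hα₀
  have ha0 : 0 ≤ a := by rw [hadef]; positivity
  -- structural data of the tangent datum `X := Nn − X₀`
  obtain ⟨hXs, hXP, -⟩ := mem_frameFreeBlockLandauW_struct h.tangent
  have hXP' : IsPeriodicDir X₀ ((L ^ (j + 1) * N : ℕ) : ℤ) := by rw [Nat.mul_comm]; exact h.per
  -- (1) the local quadratic letter `hφ` from the fibre equation, the BOX-local END and the BOX majorant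
  have hφ : ∀ z ∈ periodBox (d := d) N, ∀ κ : Fin d,
      ‖dirIter L (j + 1) (cavg L UB) X₀ z κ‖ ≤ C₂ * ((L : ℝ) ^ (j + 1) * m z κ) ^ 2 := by
    intro z _ κ
    have hσz : 4 * (3 + 12 * (d : ℝ)) ^ 2 * (L : ℝ) ^ (j + 1) * m z κ ≤ rho0 d L ^ 2 :=
      (mul_le_mul_of_nonneg_left (hmα z κ) (by positivity)).trans hσ
    have := norm_dirIter_le_of_fibre_box hL hWu hWP hx hsm hWx hA h.skew hXP' hα₀0 h.sup hσ hfib z κ (hm.nonneg z κ)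
      (hm.dom z κ) hσz
    rw [hC₂def]; exact this
  -- (2) the pre-sizes of `Nn` from the letters
  have hsL : (α₀ + αN) * (L : ℝ) ^ (j + 1) ≤ 1 := by
    have h1 : α₀ + αN ≤ α₀ + 43 * αN := by linarith
    exact (mul_le_mul_of_nonneg_right h1 (by positivity)).trans hJ1
  obtain ⟨hN1, hN2, hN3⟩ := preSizes_of_letters (N := N) hL1 (j + 1) (cavg L UB) (X₀ := X₀) (Nn := Nn)
    (φ := dirIter L (j + 1) (cavg L UB) X₀) (m := m) (C₂ := C₂) (C := C) (a := a)
    hα₀0 hαN0 hC₂0 hm.hC hc₁ hc₂ hc₃ hc₄ ha0 hm.nonneg hmα hm.sq hφ hR1 hR2 hR3 hR4 (by rw [hC₂def]; exact hρ) hsL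
  -- (3) the moving plaquette radius from 3b
  have hs32 : α₀ + αN < 1 / 32 := by linarith
  have hXsup : ∀ y μ, ‖Nn y μ - X₀ y μ‖ ≤ α₀ + αN := fun y μ =>
    (norm_sub_le _ _).trans (by rw [add_comm]; exact add_le_add (h.sup y μ) (hNsup y μ))
  have hX32 : ∀ y μ, ‖Nn y μ - X₀ y μ‖ ≤ 1 / 32 := fun y μ => (hXsup y μ).trans hs32.le
  have hX₀32 : ∀ y μ, ‖X₀ y μ‖ ≤ 1 / 32 := fun y μ => (h.sup y μ).trans (by linarith)
  have hNgs : IsSkewDir (normalPart X₀ fun y μ => Nn y μ - X₀ y μ) := normalPart_skew h.skew hXs hX₀32 hX32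
  have hαN32 : αN < 1 / 32 := by linarith
  have hNgsub : ∀ y μ, ‖normalPart X₀ (fun y μ => Nn y μ - X₀ y μ) y μ - Nn y μ‖ ≤ 2048 * (α₀ + αN) * αN := by
    intro y μ
    have hb := norm_normalPart_sub_le (X₀ := X₀) (Nn := Nn) (y := y) (μ := μ) ((hXsup y μ).trans_lt hs32)
      ((hNsup y μ).trans_lt hαN32)
    have h1 : 0 ≤ ‖Nn y μ‖ := norm_nonneg _
    have hs0 : 0 ≤ α₀ + αN := by positivity
    have h2 : ‖Nn y μ - X₀ y μ‖ * ‖Nn y μ‖ ≤ (α₀ + αN) * αN := mul_le_mul (hXsup y μ) (hNsup y μ) h1 hs0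
    have h3 : 2048 * ‖Nn y μ - X₀ y μ‖ * ‖Nn y μ‖ ≤ 2048 * (α₀ + αN) * αN := by
      have := mul_le_mul_of_nonneg_left h2 (by norm_num : (0:ℝ) ≤ 2048)
      linarith [this]
    exact hb.trans h3
  have hNgsup : ∀ y μ, ‖normalPart X₀ (fun y μ => Nn y μ - X₀ y μ) y μ‖ ≤ (1 + 2048 * (α₀ + αN)) * αN := by
    intro y μ
    calc ‖normalPart X₀ (fun y μ => Nn y μ - X₀ y μ) y μ‖
        = ‖(normalPart X₀ (fun y μ => Nn y μ - X₀ y μ) y μ - Nn y μ) + Nn y μ‖ := by rw [sub_add_cancel]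
      _ ≤ ‖normalPart X₀ (fun y μ => Nn y μ - X₀ y μ) y μ - Nn y μ‖ + ‖Nn y μ‖ := norm_add_le _ _
      _ ≤ 2048 * (α₀ + αN) * αN + αN := add_le_add (hNgsub y μ) (hNsup y μ)
      _ = (1 + 2048 * (α₀ + αN)) * αN := by ring
  have h42 : 1 + 2048 * (α₀ + αN) ≤ 42 := by linarith
  have hαN' : (1 + 2048 * (α₀ + αN)) * αN ≤ 1 / 64 := by
    have hb : (1 + 2048 * (α₀ + αN)) * αN ≤ 42 * αN := mul_le_mul_of_nonneg_right h42 hαN0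
    linarith
  have hsmall : ∀ t ∈ Icc (0:ℝ) 1, ∀ p ∈ perWin d (N * L ^ (j + 1)),
      ‖((fhol (vary (cavg L UB) (pathΓ (fun y μ => Nn y μ - X₀ y μ) (normalPart X₀ fun y μ => Nn y μ - X₀ y μ) t) 1) p
        : (Matrix n n ℂ)ˣ) : Matrix n n ℂ) - 1‖ ≤ a := by
    intro t ht p hp
    have h3b := small_of_residual_data_poly hWu h.skew hXs hNgs (X₀ := X₀) (Nn := Nn) (fun _ _ => rfl) hNgsub h.sup
      (by linarith) hXsup hNgsup hs32.le hαN' (perWin d (N * L ^ (j + 1))) hxW hxA haN ht p hp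
    rw [hadef]; exact h3b
  -- (4) file 2
  exact decomposedRep_of_linearNormalPart hL1 hN j hWu admW h hα₀ hNP hαN0 hNsup hαN hJ1 ha0 hN1 hN2 hN3 hsmall

end

end Summit.QuantumFields.BalabanUV.T4Continuum.NE3DecomposedRepOfShapesBox
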